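import Summits.QuantumFields.YangMills.Theorems.BalabanUVNodesN06Eq3132FromStateKnitQ
import Literature.MathematicalPhysics.QuantumFieldTheory.Balaban1983to89.B9Eq3132KnitTestFamilyP1
import Literature.MathematicalPhysics.QuantumFieldTheory.Balaban1983to89.B9Eq3115KnitLetterYNumerics

/-!
# BalabanUVNodes ∕ N06 ([B9], `Dag.B9_main`) — ROW 26 AT THE KNIT PAIR, PIECES 6–7: THE KNIT TEST FAMILY (the transported tent bumps with row-rebased amplitudes) INHABITS
# PIECE 5's DISPLAYED BINDER `hTt` ((P′2)ᴷ ∧ (P′1)ᴷ) FROM THE REGIME BRIDGE AND x-FREE NUMERICS; ROW 26 (`B9.Stmt3132Printed`) FOR THE `ν`-READINGS OF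
# `(Q G_D Q⋆)⁻¹ ∕ (Q G₁ Q⋆)⁻¹` AT PRINT's KNIT AVERAGING THEN FOLLOWS FROM PIECE 5 WITHOUT A TEST-FAMILY HYPOTHESIS (consumer recipe below)

Track A of `YM-PLAN.md` (cell `pub-ymgap`, HUMAN RULING D-0062), node **N06** = [Balaban1985BackgroundPropagators]; pieces 6–7 of «P-Q26-knit» (KA's displayed `s3132K`;
seat `pub-ymgap-dag-n06-l` g38, 2026-08-30).  Piece 5 (`N06Eq3132FromStateKnitQ.s3132_nu_knit_of_stepS_R`) reduced row 26 at the knit pair to the Sect.-D state tuple, row 17 at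
`Δ_a^Q` (KA's `hΔAK`), the adjointness of the pair, the regime bridge + knit numerics, and ONE displayed test family `Tt` with (P′2)ᴷ ∕ (P′1)ᴷ (`hTt`).  THIS FILE inhabits
`hTt` with the EXPLICIT family `T x U Ψ := tentOp x (bumpProfile x) U (ι ↦ R(U(Γ^{taxi}_{c→x₀}))Ψ(ι))` — n06-i's transported tent bumps fed with the row-rebased amplitude —
from `Literature.….B9Eq3132KnitTestFamilyP2.p2_knit` ((P′2)ᴷ, `ϑ = 15∕16`) and `….B9Eq3132KnitTestFamilyP1.energy_knit_tentOp_rebase_le` ((P′1)ᴷ), the (hW)∕(hP)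
smallness read off print's class through `baseSmall_of_reg335P`.  CONSUMER RECIPE (the gate's dedup forbids restating piece 5 with `hTt` discharged — same conclusion):
call `N06Eq3132FromStateKnitQ.s3132_nu_knit_of_stepS_R … hΔ _ (hTt_knit_of_pins θ M⋆ R₁ R₂ 𝔮 𝔮s h𝔮 hadj Δ hΔdef hc hRP hα' hαQ hα3 hα2 haK hKpl hT16) hstate` (the family `Tt`
is inferred from `hTt_knit_of_pins`).  New displayed inputs vs piece 5: the pin
`hΔdef : Δ x U = deltaAQY x (𝔮 x) (𝔮s x) parKnitY (GpY parKnitY) U` (KA's letter, `rfl` at the record), the knit-leg numerics `C₀α₀′ ≤ 1∕3`, `2α₀′ ≤ c₂′` (KA's `hαK3 ∕ hαK2`)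
and ONE new x-free numeric `hT16 : (α₀′m₀)²·2Nb₁·2(d+1)C_Θ ≤ b₀∕256` — inhabited together with every other knit-law numeric below any `amax` by §2
`knitTestWindow_inhabited_le` (this seat's `B9Eq3115KnitLetterYNumerics.knitWindow_inhabited_le` + one more smallness of `α₀′`).
HONEST FRAMING: composition of landed theorems; Sect.-D state, `hΔ` (row 17 at the knit pair), regime bridge and numerics are HYPOTHESES of printed∕elementary species;
nothing of [B9] ∕ [4] asserted; COUNT-NEUTRAL; N06 NOT discharged; nothing continuum ∕ OS ∕ mass gap ∕ Clay.  0 `def`, 0 `sorry`.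
[cite: Balaban1985BackgroundPropagators, (3.132) p.422, Thm 3.12 pp.421–423, Thm 3.11 p.416, (3.115) p.418, (3.26) p.395, (3.35)–(3.36) p.396, (3.69) p.404; Balaban1984PropagatorsII,
(2.147) p.248, (2.142) p.248, Prop. 2.7 (2.149) p.249, (2.16) p.225; Balaban1985Averaging, (139)–(147) pp.39–40, Prop. 2 p.26]
-/

noncomputable section

namespace Summit.QuantumFields.YangMills.BalabanUVNodes.N06Eq3132KnitTestFamilyQ

open scoped Matrix.Norms.L2Operator
open scoped Matrix.Norms.L2Operator
open Literature.MathematicalPhysics.QuantumFieldTheory.Balaban1983to89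
open Literature.MathematicalPhysics.QuantumFieldTheory.Balaban1983to89.Node00
open Literature.MathematicalPhysics.QuantumFieldTheory.Balaban1983to89.B6RandomWalk (HasMajorant)
open Literature.MathematicalPhysics.QuantumFieldTheory.Balaban1983to89.B11SectG (HasMaj BlockNorm)
open Literature.MathematicalPhysics.QuantumFieldTheory.Balaban1983to89.B9Thm34Ext (toB6)
open Literature.MathematicalPhysics.QuantumFieldTheory.Balaban1983to89.B6Ineq2142KLevelV1 (lvl β)
open Literature.MathematicalPhysics.QuantumFieldTheory.Balaban1983to89.B6GlobalChartV1 (blkV1)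
open Literature.MathematicalPhysics.QuantumFieldTheory.Balaban1983to89.B6KLevelCensusIndexV1 (KIdx kGeo)
open Literature.MathematicalPhysics.QuantumFieldTheory.Balaban1983to89.B9Thm312Whole (Ops Identities GeoOK cNorm)
open Literature.MathematicalPhysics.QuantumFieldTheory.Balaban1983to89.B9Thm312WholeClasses (cNormR)
open Literature.MathematicalPhysics.QuantumFieldTheory.Balaban1983to89.B9Thm312WholeStepRegular (StepS)
open Literature.MathematicalPhysics.QuantumFieldTheory.Balaban1983to89.B9PinMembersKLevelV1 (MemberY geo9Y)
open Literature.MathematicalPhysics.QuantumFieldTheory.Balaban1983to89.B9BackgroundsKLevelV1R (RegFamY bg9YR)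
open Literature.MathematicalPhysics.QuantumFieldTheory.Balaban1983to89.B7Prop2SpecialUnitary (specialUnitaryUnits specialUnitaryUnits_le_unitaryUnits)
open Literature.MathematicalPhysics.QuantumFieldTheory.Balaban1983to89.B9CoReadingCoords (XBK blkBK GcoK)
open Literature.MathematicalPhysics.QuantumFieldTheory.Balaban1983to89.B9CoReadingCoordsTranspose (TrIdx trBasis)
open Literature.MathematicalPhysics.QuantumFieldTheory.Balaban1983to89.B9Thm311ReadingCoords (trIP PosDefTr IsSymmTr IsAdjTr)
open Literature.MathematicalPhysics.QuantumFieldTheory.Balaban1983to89.B9RWSumsReadsNbr (nbr)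
open Literature.MathematicalPhysics.QuantumFieldTheory.Balaban1983to89.B9Eq3132RingInverseReading (normMatY)
open Literature.MathematicalPhysics.QuantumFieldTheory.Balaban1983to89.B9Eq3132NuReading (lamInvY nuY siteKernelOfOpNu)
open Literature.MathematicalPhysics.QuantumFieldTheory.Balaban1983to89.B9Eq3132NuReadingR (stmt3132Printed_nu_of_coercive_decay_R)
open Literature.MathematicalPhysics.QuantumFieldTheory.Balaban1983to89.B9Eq3132CTInputs (CoerciveUnder DecayUnder)
open Literature.MathematicalPhysics.QuantumFieldTheory.Balaban1983to89.B9Eq3132ScalarIndex (geoComap)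
open Literature.MathematicalPhysics.QuantumFieldTheory.Balaban1983to89.B9Eq3132FromStateR (majorants4_of_stepS_R)
open Literature.MathematicalPhysics.QuantumFieldTheory.Balaban1983to89.Node00.OpsYQLetter (QLetterY QsLetterY adjTrY)
open Literature.MathematicalPhysics.QuantumFieldTheory.Balaban1983to89.B9Eq316AveragingTransposeZd (alphaQ)
open Literature.MathematicalPhysics.QuantumFieldTheory.Balaban1983to89.B9Eq3115KnitLetterY (QknitY)
open Literature.MathematicalPhysics.QuantumFieldTheory.Balaban1983to89.B9C2FormBoxRegimeY (Kpl)
open Literature.MathematicalPhysics.QuantumFieldTheory.Balaban1983to89.B9BackgroundsKLevelV1P (bg9KP)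
open Summit.QuantumFields.YangMills.BalabanUVNodes.N06Eq3132DecayFromMajorantKnitQ (decayUnder_QGQOfQY_knit_of_majorants_R)
open Summit.QuantumFields.YangMills.BalabanUVNodes.N06Eq3132CoerciveFromGAKnitQ (coerciveUnder_of_subMajorants_knit_R)
open Summit.QuantumFields.YangMills.BalabanUVNodes.N06Eq3132CoerciveVariationalQ (hcoA_of_testFamily_QR)
open Literature.MathematicalPhysics.QuantumFieldTheory.Balaban1983to89.B9Eq39Adjoint (R)
open Literature.MathematicalPhysics.QuantumFieldTheory.Balaban1983to89.B9Eq3132NuReading (lamY)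
open Literature.MathematicalPhysics.QuantumFieldTheory.Balaban1983to89.B9Eq3132TentOperator (tentOp)
open Literature.MathematicalPhysics.QuantumFieldTheory.Balaban1983to89.B9Eq3132ApproxRightInverse (bumpProfile)
open Literature.MathematicalPhysics.QuantumFieldTheory.Balaban1983to89.B9Eq3132TentBumps (Cth)
open Literature.MathematicalPhysics.QuantumFieldTheory.Balaban1983to89.B9Eq3132TentOverlap (CQ)
open Literature.MathematicalPhysics.QuantumFieldTheory.Balaban1983to89.B9Eq3132EnergyOfTents (Cp1 Cp1_pos)
open Literature.MathematicalPhysics.QuantumFieldTheory.Balaban1983to89.B9Eq3132TentPlaquettes (varpi varpi_nonneg M_pos)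
open Literature.MathematicalPhysics.QuantumFieldTheory.Balaban1983to89.B9Eq3132KnitTestFamilyP2 (p2_knit)
open Literature.MathematicalPhysics.QuantumFieldTheory.Balaban1983to89.B9Eq3132KnitTestFamilyP1 (energy_knit_tentOp_rebase_le baseSmall_of_reg335P)
open Literature.MathematicalPhysics.QuantumFieldTheory.Balaban1983to89.B9Eq3115KnitLetterY (zSrc)
open Literature.MathematicalPhysics.QuantumFieldTheory.Balaban1983to89.B9Eq3115KnitLetterYOnto (kCol kCol_nonneg)
open Literature.MathematicalPhysics.QuantumFieldTheory.Balaban1983to89.B9Eq3115KnitLetterYNumerics (knitWindow_inhabited_le)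
open Literature.MathematicalPhysics.QuantumFieldTheory.Balaban1983to89.B9B8AveragingJunction (parKnitY)
open Literature.MathematicalPhysics.QuantumFieldTheory.Balaban1983to89.B7Prop2Explicit (C0 c2')
open Literature.MathematicalPhysics.QuantumFieldTheory.Balaban1983to89.B6GlobalChartV1 (PV)

/-! ## §1 ★★★ The knit test family inhabits piece 5's `hTt` -/

section TestFamily

variable {N : ℕ} [Nonempty (Fin N)]
variable (θ : Stage3Params) (Mstar : ℕ) (R₁ R₂ : RegFamY θ.d₆ θ.ℓ₆ θ.hd' θ.hL' θ.b₀ θ.b₁ Mstar (Matrix (Fin N) (Fin N) ℂ))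

/-- ★★★ **THE KNIT TEST FAMILY WITH (P′2)ᴷ ∧ (P′1)ᴷ — PIECE 5's `hTt`, INHABITED**: over the carrier `bg9YR … SU(N) R₁ R₂`, for an averaging pair `𝔮 x U = QknitY x U` with a
trace-adjoint partner `𝔮s` on the carrier's (3.35) (`hadj`), the form `Δ x U = Δ_a^𝔮(U; parKnitY, GpY parKnitY)` (pinned, `hΔdef`), a regime bridge `hRP` to print's class
`(bg9KP … SU(N) x).Reg335 c₀` (`c₀ ≤ 10`) and the x-free knit numerics `0 < α₀′ ≤ α_Q`, `C₀α₀′ ≤ 1∕3`, `2α₀′ ≤ c₂′`, `K_pl(a)L⁴ < α₀′ (0 ≤ a ≤ aK)`,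
`(α₀′m₀)²·2Nb₁·2(d+1)C_Θ ≤ b₀∕256`: the family `T x U Ψ := tentOp x (bumpProfile x) U (ι ↦ R(U(Γ^{taxi}_{c→x₀}))Ψ(ι))` satisfies, below `M·α₀ ≤ aK`,
(P′2)ᴷ `(1 − 15∕16)‖Ψ‖² ≤ Re tr⟨𝔮(U)(TΨ), Λ⁻¹Ψ⟩` and (P′1)ᴷ `Re tr⟨TΨ, Δ(U)(TΨ)⟩ ≤ C‖Ψ‖²` with `C = C_{P1}(d,L,b₁,ω_K,ϖ_K) + C_Q(d,L,b₁) + 2(α₀′m₀)²·2Nb₁·2(d+1)C_Θ`.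
[cite: Balaban1984PropagatorsII, (2.147) p.248; Balaban1985BackgroundPropagators, (3.132) p.422, (3.26) p.395, (3.115) p.418, (3.35)–(3.36) p.396, (3.69) p.404; Balaban1985Averaging, (139)–(147) pp.39–40, Prop. 2 p.26] -/
theorem hTt_knit_of_pins {c35 : ℝ}
    (𝔮 : ∀ x : MemberY θ.d₆ θ.ℓ₆ θ.hd' θ.hL' θ.b₀ θ.b₁ Mstar, QLetterY (Matrix (Fin N) (Fin N) ℂ) x.toKIdx)
    (𝔮s : ∀ x : MemberY θ.d₆ θ.ℓ₆ θ.hd' θ.hL' θ.b₀ θ.b₁ Mstar, QsLetterY (Matrix (Fin N) (Fin N) ℂ) x.toKIdx)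
    (h𝔮 : ∀ (x : MemberY θ.d₆ θ.ℓ₆ θ.hd' θ.hL' θ.b₀ θ.b₁ Mstar) (U : CfgY (Matrix (Fin N) (Fin N) ℂ) x.toKIdx), 𝔮 x U = QknitY x.toKIdx U)
    (hadj : ∀ (x : MemberY θ.d₆ θ.ℓ₆ θ.hd' θ.hL' θ.b₀ θ.b₁ Mstar) (α₀ : ℝ) (U : (bg9YR (Matrix (Fin N) (Fin N) ℂ) (specialUnitaryUnits (Fin N)) R₁ R₂ x).Cfg),
      (bg9YR (Matrix (Fin N) (Fin N) ℂ) (specialUnitaryUnits (Fin N)) R₁ R₂ x).Reg335 c35 α₀ U → IsAdjTr (fun _ => (1 : ℝ)) (fun _ => (1 : ℝ)) (𝔮 x U) (𝔮s x U))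
    (Δ : ∀ x : MemberY θ.d₆ θ.ℓ₆ θ.hd' θ.hL' θ.b₀ θ.b₁ Mstar, CfgY (Matrix (Fin N) (Fin N) ℂ) x.toKIdx →
      ((FBondY x.toKIdx → Matrix (Fin N) (Fin N) ℂ) →ₗ[ℂ] (FBondY x.toKIdx → Matrix (Fin N) (Fin N) ℂ)))
    (hΔdef : ∀ (x : MemberY θ.d₆ θ.ℓ₆ θ.hd' θ.hL' θ.b₀ θ.b₁ Mstar) (U : CfgY (Matrix (Fin N) (Fin N) ℂ) x.toKIdx),
      Δ x U = deltaAQY x.toKIdx (𝔮 x) (𝔮s x) (parKnitY x.toKIdx) (GpY x.toKIdx (parKnitY x.toKIdx)) U)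
    {c₀ : ℝ} (hc : c₀ ≤ 10)
    (hRP : ∀ (x : MemberY θ.d₆ θ.ℓ₆ θ.hd' θ.hL' θ.b₀ θ.b₁ Mstar) (α₀ : ℝ) (U : (bg9YR (Matrix (Fin N) (Fin N) ℂ) (specialUnitaryUnits (Fin N)) R₁ R₂ x).Cfg),
      (bg9YR (Matrix (Fin N) (Fin N) ℂ) (specialUnitaryUnits (Fin N)) R₁ R₂ x).Reg335 c35 α₀ U →
        (bg9KP (Matrix (Fin N) (Fin N) ℂ) (specialUnitaryUnits (Fin N)) x.toKIdx).Reg335 c₀ α₀ U)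
    {α₀' : ℝ} (hα' : 0 < α₀') (hαQ : α₀' ≤ alphaQ (θ.d₆ + 1) (θ.ℓ₆ + 1)) (hα3 : C0 (θ.d₆ + 1) * α₀' ≤ 1 / 3) (hα2 : 2 * α₀' ≤ c2' (θ.d₆ + 1) (θ.ℓ₆ + 1))
    {aK : ℝ} (haK : 0 < aK)
    (hKpl : ∀ (x : MemberY θ.d₆ θ.ℓ₆ θ.hd' θ.hL' θ.b₀ θ.b₁ Mstar) (a : ℝ), 0 ≤ a → a ≤ aK → Kpl x.toKIdx a * (kGeo x.toKIdx).L ^ 4 < α₀')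
    (hT16 : (α₀' * (2 * ((θ.d₆ : ℝ) + 1) * kCol (θ.d₆ + 1) (θ.ℓ₆ + 1) + 8 * ((θ.d₆ : ℝ) + 2) ^ 2)) ^ 2 * (2 * (N : ℝ) * θ.b₁) * (2 * ((θ.d₆ : ℝ) + 1) * Cth θ.d₆)
      ≤ θ.b₀ / 256) :
    ∃ Mt aT ϑ C : ℝ, 0 < Mt ∧ 0 < aT ∧ ϑ < 1 ∧ 0 < C ∧
      ∀ x : MemberY θ.d₆ θ.ℓ₆ θ.hd' θ.hL' θ.b₀ θ.b₁ Mstar, Mt ≤ (geo9Y x).M → ∀ α₀ : ℝ, 0 < α₀ → (geo9Y x).M * α₀ ≤ aT →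
        ∀ U : (bg9YR (Matrix (Fin N) (Fin N) ℂ) (specialUnitaryUnits (Fin N)) R₁ R₂ x).Cfg,
          (bg9YR (Matrix (Fin N) (Fin N) ℂ) (specialUnitaryUnits (Fin N)) R₁ R₂ x).Reg335 c35 α₀ U →
          (bg9YR (Matrix (Fin N) (Fin N) ℂ) (specialUnitaryUnits (Fin N)) R₁ R₂ x).Reg336 c35 α₀ U →
            (∀ Ψ : IBondY x.toKIdx → Matrix (Fin N) (Fin N) ℂ,
              (1 - ϑ) * trIP (fun _ => (1 : ℝ)) Ψ Ψ ≤
                trIP (fun _ => (1 : ℝ))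
                  (𝔮 x U (tentOp x.toKIdx (bumpProfile x.toKIdx) U (fun ι => R (parTaxiV U (B15DeterminingSets.embIter (ι.1.1 : ℕ) ι.1.2.src)
                    (B10Eq27TorusAxialLog.transl (0 : Site (PV θ.d₆ θ.ℓ₆ x.m x.K θ.hd' θ.hL') 0) (B7Prop1Local.loK (θ.ℓ₆ + 1) (ι.1.1 : ℕ) (zSrc x.toKIdx ι)))) (Ψ ι))))
                  (fun y => lamInvY x.toKIdx y • Ψ y)) ∧
            (∀ Ψ : IBondY x.toKIdx → Matrix (Fin N) (Fin N) ℂ,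
              trIP (fun _ => (1 : ℝ))
                  (tentOp x.toKIdx (bumpProfile x.toKIdx) U (fun ι => R (parTaxiV U (B15DeterminingSets.embIter (ι.1.1 : ℕ) ι.1.2.src)
                    (B10Eq27TorusAxialLog.transl (0 : Site (PV θ.d₆ θ.ℓ₆ x.m x.K θ.hd' θ.hL') 0) (B7Prop1Local.loK (θ.ℓ₆ + 1) (ι.1.1 : ℕ) (zSrc x.toKIdx ι)))) (Ψ ι)))
                  (Δ x U (tentOp x.toKIdx (bumpProfile x.toKIdx) U (fun ι => R (parTaxiV U (B15DeterminingSets.embIter (ι.1.1 : ℕ) ι.1.2.src)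
                    (B10Eq27TorusAxialLog.transl (0 : Site (PV θ.d₆ θ.ℓ₆ x.m x.K θ.hd' θ.hL') 0) (B7Prop1Local.loK (θ.ℓ₆ + 1) (ι.1.1 : ℕ) (zSrc x.toKIdx ι)))) (Ψ ι)))) ≤
                C * trIP (fun _ => (1 : ℝ)) Ψ Ψ) := by
  have hb₁ : 0 ≤ θ.b₁ := θ.hb.1.le.trans θ.hb.2
  have hGU := specialUnitaryUnits_le_unitaryUnits (n := Fin N)
  set Lr : ℝ := (((θ.ℓ₆ + 1 : ℕ) : ℝ)) with hLr
  set ϖK : ℝ := varpi (10 * Lr ^ 3 * aK) with hϖK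
  set ωK : ℝ := 2 * ((θ.d₆ : ℝ) + 1) * Lr ^ 2 * ϖK with hωK
  have hϖ : 0 ≤ ϖK := varpi_nonneg (by positivity)
  set δsq : ℝ := (α₀' * (2 * ((θ.d₆ : ℝ) + 1) * kCol (θ.d₆ + 1) (θ.ℓ₆ + 1) + 8 * ((θ.d₆ : ℝ) + 2) ^ 2)) ^ 2 * (2 * (N : ℝ) * θ.b₁) with hδsq
  have hδsq0 : 0 ≤ δsq := by have := kCol_nonneg (θ.d₆ + 1) (θ.ℓ₆ + 1); positivity
  have hCQ : 0 ≤ CQ θ.d₆ θ.ℓ₆ θ.b₁ := by unfold CQ; positivity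
  have hCth : 0 ≤ 2 * ((θ.d₆ : ℝ) + 1) * Cth θ.d₆ := by unfold Cth; positivity
  refine ⟨1, aK, 15 / 16, Cp1 θ.d₆ θ.ℓ₆ θ.b₁ ωK ϖK + CQ θ.d₆ θ.ℓ₆ θ.b₁ + 2 * δsq * (2 * ((θ.d₆ : ℝ) + 1) * Cth θ.d₆), one_pos, haK, by norm_num,
    by have := Cp1_pos θ.d₆ θ.ℓ₆ (ω := ωK) hb₁ hϖ; positivity, fun x _ α₀ hα₀ hMa U hU _ => ?_⟩
  have hregP := hRP x α₀ U hU
  have hMα : 0 ≤ (kGeo x.toKIdx).M * α₀ := mul_nonneg (M_pos x.toKIdx).le hα₀.le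
  have hKx : Kpl x.toKIdx ((kGeo x.toKIdx).M * α₀) * (kGeo x.toKIdx).L ^ 4 < α₀' := hKpl x _ hMα hMa
  -- the row units (inverses of the taxicab transports), keyed as in `B9Thm311PosDefQknitOfRegYP335AtLettersY`
  set T : IBondY x.toKIdx → (Matrix (Fin N) (Fin N) ℂ)ˣ := fun ι => (parTaxiV U (B15DeterminingSets.embIter (ι.1.1 : ℕ) ι.1.2.src)
    (B10Eq27TorusAxialLog.transl (0 : Site (PV θ.d₆ θ.ℓ₆ x.m x.K θ.hd' θ.hL') 0) (B7Prop1Local.loK (θ.ℓ₆ + 1) (ι.1.1 : ℕ) (zSrc x.toKIdx ι))))⁻¹ with hTdef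
  have hT : ∀ ι, T ι = (parTaxiV U (B15DeterminingSets.embIter (ι.1.1 : ℕ) ι.1.2.src)
      (B10Eq27TorusAxialLog.transl (0 : Site (PV θ.d₆ θ.ℓ₆ x.m x.K θ.hd' θ.hL') 0) (B7Prop1Local.loK (θ.ℓ₆ + 1) (ι.1.1 : ℕ) (zSrc x.toKIdx ι))))⁻¹ := fun ι => rfl
  have hTinv : ∀ ι, (T ι)⁻¹ = parTaxiV U (B15DeterminingSets.embIter (ι.1.1 : ℕ) ι.1.2.src)
      (B10Eq27TorusAxialLog.transl (0 : Site (PV θ.d₆ θ.ℓ₆ x.m x.K θ.hd' θ.hL') 0) (B7Prop1Local.loK (θ.ℓ₆ + 1) (ι.1.1 : ℕ) (zSrc x.toKIdx ι))) := fun ι => inv_inv _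
  refine ⟨fun Ψ => ?_, fun Ψ => ?_⟩
  · have h := p2_knit x.toKIdx θ.hb.1 hb₁ hc hMα hregP hα' hαQ hKx hT16 T hT Ψ
    simp only [hTinv] at h
    rw [h𝔮 x U]
    exact h
  · obtain ⟨hW, hP⟩ := baseSmall_of_reg335P (G := specialUnitaryUnits (Fin N)) hGU x hc hα₀ hMa hregP
    have h := energy_knit_tentOp_rebase_le x.toKIdx hGU hb₁ hc hMα hregP hα' hαQ hα3 hα2 hKx hϖ hW hP T hT (𝔮 x) (𝔮s x) (h𝔮 x U) (hadj x α₀ U hU) Ψ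
    simp only [hTinv] at h
    rw [hΔdef x U]
    exact h

end TestFamily

/-! ## §2 The knit-law numerics together with the test-family numeric are inhabited below any `amax` -/

section Numerics

open Literature.MathematicalPhysics.QuantumFieldTheory.Balaban1983to89.B6KLevelCensusIndexV1 (KIdx)

/-- ★ **THE KNIT NUMERICS WINDOW WITH THE TEST-FAMILY SMALLNESS, INHABITED** (x-free): for `0 < b₀`, `0 ≤ b₁` and any `amax > 0` there are `0 < α₀′ ≤ amax` and `a₁ > 0` with every
conjunct of `B9Eq3115KnitLetterYNumerics.knitWindow_inhabited_le` AND `(α₀′m₀)²·2Nb₁·2(d+1)C_Θ ≤ b₀∕256` (take `α₀′ ≤ min(1, b₀∕(256(m₀²·2Nb₁·2(d+1)C_Θ + 1)))`).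
[cite: Balaban1985Averaging, Proposition 5 p.42, (147) p.40; Balaban1984PropagatorsII, (2.147) p.248, (2.16) p.225; Balaban1985BackgroundPropagators, (3.35) p.396] -/
theorem knitTestWindow_inhabited_le (d ℓ N : ℕ) {b₀ b₁ amax : ℝ} (hb₀ : 0 < b₀) (hb₁ : 0 ≤ b₁) (hamax : 0 < amax) :
    ∃ α₀' a₁ : ℝ, 0 < α₀' ∧ α₀' ≤ amax ∧ 0 < a₁ ∧
      α₀' ≤ alphaQ (d + 1) (ℓ + 1) ∧ C0 (d + 1) * α₀' ≤ 1 / 3 ∧ 2 * α₀' ≤ c2' (d + 1) (ℓ + 1) ∧ 4 * α₀' ≤ c2' (d + 1) (ℓ + 1) ∧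
      Real.exp (4 * (800 * (((d + 1 : ℕ) : ℝ) + 1) ^ 2 * (((d + 1 : ℕ) : ℝ) + 4)) * α₀') < 2 ∧
      kCol (d + 1) (ℓ + 1) * α₀' < 1 ∧
      (∀ a : ℝ, 0 ≤ a → a ≤ a₁ →
        2 * (10 * ((ℓ : ℝ) + 1) * a) * (1 + 10 * ((ℓ : ℝ) + 1) * a) * Real.exp (4 * (10 * ((ℓ : ℝ) + 1) * a)) * ((ℓ : ℝ) + 1) ^ 4 < α₀') ∧
      (∀ {hd : 1 ≤ d + 1} {hL : Odd (ℓ + 1) ∧ 1 < ℓ + 1} {b₀' b₁' : ℝ} (i : KIdx d ℓ hd hL b₀' b₁') (a : ℝ), 0 ≤ a → a ≤ a₁ → Kpl i a * (kGeo i).L ^ 4 < α₀') ∧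
      (α₀' * (2 * ((d : ℝ) + 1) * kCol (d + 1) (ℓ + 1) + 8 * ((d : ℝ) + 2) ^ 2)) ^ 2 * (2 * (N : ℝ) * b₁) * (2 * ((d : ℝ) + 1) * Cth d) ≤ b₀ / 256 := by
  set K : ℝ := (2 * ((d : ℝ) + 1) * kCol (d + 1) (ℓ + 1) + 8 * ((d : ℝ) + 2) ^ 2) ^ 2 * (2 * (N : ℝ) * b₁) * (2 * ((d : ℝ) + 1) * Cth d) with hK
  have hk := kCol_nonneg (d + 1) (ℓ + 1)
  have hK0 : 0 ≤ K := by rw [hK]; unfold Cth; positivity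
  set a' : ℝ := min amax (min 1 (b₀ / (256 * (K + 1)))) with ha'
  have ha'pos : 0 < a' := lt_min hamax (lt_min one_pos (div_pos hb₀ (by positivity)))
  obtain ⟨α₀', a₁, hα0, hαle, ha₁, h1, h2, h3, h4, h5, h6, h7, h8⟩ := knitWindow_inhabited_le (d := d) (ℓ := ℓ) ha'pos
  have hα1 : α₀' ≤ 1 := hαle.trans ((min_le_right _ _).trans (min_le_left _ _))
  have hαb : α₀' ≤ b₀ / (256 * (K + 1)) := hαle.trans ((min_le_right _ _).trans (min_le_right _ _))
  refine ⟨α₀', a₁, hα0, hαle.trans (min_le_left _ _), ha₁, h1, h2, h3, h4, h5, h6, h7, fun i a ha hale => h8 i a ha hale, ?_⟩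
  have e : (α₀' * (2 * ((d : ℝ) + 1) * kCol (d + 1) (ℓ + 1) + 8 * ((d : ℝ) + 2) ^ 2)) ^ 2 * (2 * (N : ℝ) * b₁) * (2 * ((d : ℝ) + 1) * Cth d) = α₀' * (α₀' * K) := by
    rw [hK]; ring
  rw [e]
  have hK1 : 0 < K + 1 := by positivity
  have hαK : α₀' * K ≤ b₀ / 256 := by
    calc α₀' * K ≤ b₀ / (256 * (K + 1)) * K := mul_le_mul_of_nonneg_right hαb hK0
      _ ≤ b₀ / (256 * (K + 1)) * (K + 1) := mul_le_mul_of_nonneg_left (by linarith) (div_nonneg hb₀.le (by positivity))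
      _ = b₀ / 256 := by field_simp
  calc α₀' * (α₀' * K) ≤ 1 * (α₀' * K) := mul_le_mul_of_nonneg_right hα1 (mul_nonneg hα0.le hK0)
    _ ≤ b₀ / 256 := by rw [one_mul]; exact hαK

end Numerics

end Summit.QuantumFields.YangMills.BalabanUVNodes.N06Eq3132KnitTestFamilyQ

end
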